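import Literature.MathematicalPhysics.QuantumFieldTheory.Balaban1983to89.B9Eq310Hermitian

/-!
# `Balaban1983to89.B11Eq27Current` — T. Bałaban, *The variational problem and background fields in renormalization group method for lattice gauge theories*, Commun. Math. Phys. **102** (1985) 277–309 [Balaban1985Variational]: (27)–(28) p. 282 — the current `J`: «from hermiticity of DA» the first-order term of (26) is `⟨A, J⟩` (27) (= (3.11) of [5]), the two printed forms of `J = D*η⁻²Im ∂U₀ = Im η⁻²D*∂U₀`, and the bound `|J| < C₁B₃ε₁(Lʲη)⁻³` (28) from the assumption (14), PROVED on the finite-lattice carrier of `B9Eq39Adjoint` / `B9Eq310Hermitian`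

statement-level skeleton of published theorems with citation tags; proofs where landed; nothing here is a claim about the Yang–Mills mass gap

PDF held: `paper:balaban1985-cmp102-variational-background` (journal page = PDF page + 276).  Render
`run/shared/lean/pub/pub-balaban/b2b-balaban-ref1/pages/1985-cmp102-variational-background/…-p006-x2.png` (p. 282)
READ AS AN IMAGE by this seat (lit-balaban reader/typer r08, gen 2, 2026-08-21).

CITATION HEADER (lean-in-tree rule 2026-08-18).  WHAT IS REPRODUCED: SKELETON row `B11.Eq27` ((27)–(28)) of
`HOME/lit-balaban-r08/ROWS-B11.md`, previously «typed as hypothesis only» (`‖J‖ ≤ j` in `B11Prop6Scheme`).  (27) IS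
(3.11) of [5] = [Balaban1985BackgroundPropagators] at B11's letters: the pairing `⟨A, J⟩`, the current
`J = D^{η*}(η⁻² Im ∂U)` and the adjointness `⟨A, D^{η*}F⟩ = Σ_p η^d tr((D^η_U A)(p)F(p))` are `B9Eq39Adjoint.bondPair`,
`B9Eq39Adjoint.J`, `B9Eq39Adjoint.bondPair_J` (REUSED, not re-declared); the unitarity algebra (`U(b)⁻¹ = U(b)*`,
`(D*F)* = D*(F*)`) is `B9Eq310Hermitian` §4.

THE PRINT (p. 282 [PDF 6], verbatim).  «This expansion gives A(U₁U₀) = Σ_{p⊂Ω₀} η^{d−4}[1 − Re tr(U₁U₀)(∂p)] = A(U₀)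
+ Σ_{p⊂Ω₀} η^{d−2} Im tr(DA)(p)U₀(∂p) + ½⟨A, ΔA⟩ + V₀(A), (26) where the expansion of V₀(A) begins with a third order
polynomial. From hermiticity of DA we have
  Σ_{p⊂Ω₀} η^{d−2} Im tr(DA)(p)U₀(∂p) = Σ_{p⊂Ω₀} η^{d−2} tr(DA)(p) Im U₀(∂p) = ⟨A, J⟩, (27)
where
  J = D*η⁻² Im ∂U₀ = Im η⁻²D*∂U₀, |J| < C₁B₃ε₁(Lʲη)⁻³ on Ω_j, (28)
the bound holds by the assumption (14).»  ((14) p. 280: `U₀ ∈ 𝔘_k({Ω_j}, C₁B₃ε₁)`, i.e. by (2) p. 278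
`|(D*_{U₀}∂U₀)(b)| < C₁B₃ε₁η²(Lʲη)⁻³` for `b ∈ Ω_j`.)

DICTIONARY (the finite-lattice carrier of `B9Eq39Adjoint`: sites `S` (finite), directions `ι` (finite, ordered), shifts
`T μ : S ≃ S`, background `U : ι → S → 𝔸ˣ` over a `ℂ`-algebra `𝔸` with involution `*`; nothing re-declared).  `A` ↦ a
bond field `A : ι → S → 𝔸`, HERMITIAN (`A(b)* = A(b)`, «hermiticity of DA»); `(DA)(p)` = `D^η_{U₀}A` ↦ `curlη T U η A`;
`U₀(∂p)` ↦ `plaqU T U μ ν x` (a unit), UNITARY background (`U(b)⁻¹ = U(b)*`, hypothesis `hU`, «U with values in the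
unitary group»); «tr» ↦ a tracial `*`-compatible `ℂ`-linear `τ` (`τ(ab) = τ(ba)`, `τ(a*) = conj τ(a)`, e.g. the matrix
trace); «Im» of a matrix ↦ **`imPart X = (2i)⁻¹(X − X*)`** (= `B9Eq37Insertion.imC` on unitaries, `imC_eq_imPart`); «Im»
of the number `tr(DA)(p)U₀(∂p)` ↦ `Complex.im`; `D* = D^{η*}_{U₀}` on plaquette functions ↦ `divPη T U η`, so
`D*∂U₀` ↦ `divPη T U η (plaqField T U)`; `⟨A, J⟩` ↦ `bondPair η d τ A (J T U η)`; the weight `η^{d−2}` is carried as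
`η^d · (η⁻¹)²` (B9's normal form); `Σ_{p⊂Ω₀}` ↦ the sum over positively oriented plaquettes `posPlaq S ι` of the finite
lattice; `(Lʲη)⁻¹` ↦ `t⁻¹`.

WHAT IS CERTIFIED (kernel, sorry-free).  `im_trace_mul_eq`: «from hermiticity», `Im τ(XW) = τ(X·Im W)` for `X* = X`
(one plaquette); **(27)** `eq27`: both printed equalities — `η^dΣ_p(η⁻¹)²·Im τ((DA)(p)U₀(∂p)) = η^dΣ_pτ((DA)(p)·(η⁻¹)²Im
U₀(∂p)) = ⟨A, J⟩` (the second = `B9Eq39Adjoint.bondPair_J`); **(28), the two forms of `J`**: `J_eq_imPart_div`: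
`D*(η⁻²Im ∂U₀) = η⁻²·Im(D*∂U₀)` at every bond for unitary `U₀` (`*` commutes with `D*`, `B9Eq310Hermitian.star_divP`);
**(28), the bound**: `ineq28`: if `‖(D*∂U₀)(b)‖ ≤ C₁B₃ε₁η²t⁻³` (assumption (14) via (2), `t = Lʲη`) then
`‖J(b)‖ ≤ C₁B₃ε₁t⁻³`, using `‖Im X‖ ≤ ‖X‖` (`norm_imPart_le`, needs `‖X*‖ = ‖X‖`).

HONEST SCOPE — what is NOT claimed.  (i) (26) (the expansion itself) is not typed here (B9 (3.12) =
`B9Eq39Adjoint.eq312`; B11 (24)–(25) = `B11Eq24TraceExpansion`).  (ii) The carrier is B9's finite periodic lattice with an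
arbitrary unitary background, not the nested geometry `Ω_j`; (28) is certified bondwise from the bondwise form of (14),
print's strict `<` as `≤`.  (iii) «Im» needs an involution: `𝔸` carries `StarRing`/`StarModule ℂ` (and `NormedStarGroup`
for the bound) — for `N × N` matrices with the operator norm all hold.  (iv) Nothing here is progress on the summit
`Summit.QuantumFields`.  Unit `lit-balaban-r08` gen 2 (row `B11.Eq27` of `HOME/lit-balaban-r08/ROWS-B11.md`,
HOME = `run/shared/lean/pub/lit-balaban/`).
-/

noncomputable section

open Complex

namespace Literature.MathematicalPhysics.QuantumFieldTheory.Balaban1983to89.B11Eq27Current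

open Literature.MathematicalPhysics.QuantumFieldTheory.Balaban1983to89.Beta.TransportVertices
open Literature.MathematicalPhysics.QuantumFieldTheory.Balaban1983to89.B9Eq37Insertion
open Literature.MathematicalPhysics.QuantumFieldTheory.Balaban1983to89.B9Eq39Adjoint
open Literature.MathematicalPhysics.QuantumFieldTheory.Balaban1983to89.B9Eq310Hermitian

/-! ## §1 «Im» of a matrix and «from hermiticity of DA» -/
section Algebra

variable {𝔸 : Type*} [Ring 𝔸] [Algebra ℂ 𝔸] [StarRing 𝔸] [StarModule ℂ 𝔸]

/-- «Im» of an element: `Im X = (2i)⁻¹(X − X*)` (for matrices `(X − X*)/2i`; on a unitary `W`, `W* = W⁻¹`, it is the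
`Im U(∂p)` of (27), `B9Eq37Insertion.imC`). [cite: Balaban1985Variational, (27)-(28) p.282] -/
def imPart (X : 𝔸) : 𝔸 := (2 * I)⁻¹ • (X - star X)

omit [StarModule ℂ 𝔸] in
/-- On a unitary (`W⁻¹ = W*`) the complexified `Im` of [5] p. 391 is `imPart`. [cite: Balaban1985Variational, (27) p.282] -/
theorem imC_eq_imPart {W : 𝔸ˣ} (hW : ((W⁻¹ : 𝔸ˣ) : 𝔸) = star (W : 𝔸)) : imC W = imPart (W : 𝔸) := by
  rw [imC, imPart, hW]

omit [StarModule ℂ 𝔸] in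
/-- «From hermiticity of DA»: for `X* = X`, any `W` and a tracial `*`-compatible `τ` («tr»):
`Im τ(XW) = τ(X · Im W)` — one plaquette of the first equality in (27) (`X = (DA)(p)`, `W = U₀(∂p)`).
[cite: Balaban1985Variational, (27) p.282] -/
theorem im_trace_mul_eq {τ : 𝔸 →ₗ[ℂ] ℂ} (hτ : ∀ a b : 𝔸, τ (a * b) = τ (b * a))
    (hτs : ∀ a : 𝔸, τ (star a) = starRingEnd ℂ (τ a)) {X : 𝔸} (hX : star X = X) (W : 𝔸) :
    (((τ (X * W)).im : ℝ) : ℂ) = τ (X * imPart W) := by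
  have hconj : τ (X * star W) = starRingEnd ℂ (τ (X * W)) := by
    rw [← hτs, star_mul, hX, hτ]
  rw [imPart, mul_smul_comm, map_smul, mul_sub, map_sub, hconj, smul_eq_mul, Complex.sub_conj]
  have h2I : (2 * I : ℂ) ≠ 0 := mul_ne_zero two_ne_zero Complex.I_ne_zero
  field_simp
  push_cast
  ring

end Algebra

/-! ## §2 (27) on the finite lattice and the two forms of `J` in (28) -/
section Lattice

variable {𝔸 : Type*} [Ring 𝔸] [Algebra ℂ 𝔸] [StarRing 𝔸] [StarModule ℂ 𝔸]
variable {S : Type*} [Fintype S] {ι : Type*} [Fintype ι] [LinearOrder ι]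
variable (T : ι → Equiv.Perm S) (U : ι → S → 𝔸ˣ)

/-- The plaquette field `∂U₀`, `(∂U₀)(p) = U₀(∂p)`, as an `𝔸`-valued plaquette function.
[cite: Balaban1985Variational, (28) p.282] -/
def plaqField : ι → ι → S → 𝔸 := fun μ ν x => (plaqU T U μ ν x : 𝔸)

/-- **(27)**: for a HERMITIAN bond field `A` (`A(b)* = A(b)`), a UNITARY background (`U(b)⁻¹ = U(b)*`) and a tracial
`*`-compatible `τ`: `Σ_p η^{d−2} Im tr(DA)(p)U₀(∂p) = Σ_p η^{d−2} tr(DA)(p) Im U₀(∂p)` («from hermiticity of DA») and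
`Σ_p η^{d−2} tr(DA)(p) Im U₀(∂p) = ⟨A, J⟩` (= (3.11)/(3.9) of [5], `B9Eq39Adjoint.bondPair_J`), the weights written
`η^d·(η⁻¹)²`, the sums over the positively oriented plaquettes. [cite: Balaban1985Variational, (27) p.282] -/
theorem eq27 (hU : ∀ μ x, (((U μ x)⁻¹ : 𝔸ˣ) : 𝔸) = star (U μ x : 𝔸)) (τ : 𝔸 →ₗ[ℂ] ℂ)
    (hτ : ∀ a b : 𝔸, τ (a * b) = τ (b * a)) (hτs : ∀ a : 𝔸, τ (star a) = starRingEnd ℂ (τ a)) (η : ℝ) (d : ℕ)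
    {A : ι → S → 𝔸} (hA : ∀ μ x, star (A μ x) = A μ x) :
    ((η : ℂ) ^ d * ∑ q ∈ posPlaq S ι, ((η : ℂ)⁻¹) ^ 2 *
        (((τ (curlη T U η A q.2.1 q.2.2 q.1 * (plaqU T U q.2.1 q.2.2 q.1 : 𝔸))).im : ℝ) : ℂ) =
      (η : ℂ) ^ d * ∑ q ∈ posPlaq S ι,
        τ (curlη T U η A q.2.1 q.2.2 q.1 * ((((η : ℂ)⁻¹) ^ 2) • imC (plaqU T U q.2.1 q.2.2 q.1)))) ∧
    ((η : ℂ) ^ d * ∑ q ∈ posPlaq S ι,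
        τ (curlη T U η A q.2.1 q.2.2 q.1 * ((((η : ℂ)⁻¹) ^ 2) • imC (plaqU T U q.2.1 q.2.2 q.1))) =
      bondPair η d τ A (B9Eq39Adjoint.J T U η)) := by
  refine ⟨?_, (bondPair_J T U τ hτ η d A).symm⟩
  congr 1
  refine Finset.sum_congr rfl fun q _ => ?_
  have hX : star (curlη T U η A q.2.1 q.2.2 q.1) = curlη T U η A q.2.1 q.2.2 q.1 := by
    have hA' : star A = A := funext fun μ => funext fun x => hA μ x
    have h := congrFun (congrFun (congrFun (star_curlη T U hU η A) q.2.1) q.2.2) q.1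
    rw [hA'] at h
    exact h
  rw [im_trace_mul_eq hτ hτs hX, mul_smul_comm, map_smul, smul_eq_mul, imC_eq_imPart (plaqU_unitary T U hU _ _ _)]

omit [Fintype S] in
/-- `D^{η*}` of a conjugated plaquette function is the conjugate, on the unitary group: `(D*(F*))(b) = ((D*F)(b))*`
(`B9Eq310Hermitian.star_divP`, real weight `η⁻¹`). [cite: Balaban1985Variational, (28) p.282] -/
theorem divPη_star (hU : ∀ μ x, (((U μ x)⁻¹ : 𝔸ˣ) : 𝔸) = star (U μ x : 𝔸)) (η : ℝ) (F : ι → ι → S → 𝔸)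
    (μ : ι) (x : S) : divPη T U η (star F) μ x = star (divPη T U η F μ x) := by
  rw [divPη, divPη, star_smul, star_eta_inv, star_divP T U hU]

omit [StarRing 𝔸] [StarModule ℂ 𝔸] [Fintype S] in
/-- `D^{η*}` is subtractive. [cite: Balaban1985Variational, (28) p.282] -/
theorem divPη_sub (η : ℝ) (F G : ι → ι → S → 𝔸) (μ : ι) (x : S) :
    divPη T U η (F - G) μ x = divPη T U η F μ x - divPη T U η G μ x := by
  rw [sub_eq_add_neg F G, ← neg_one_smul ℂ G, divPη_add, divPη_smul, neg_one_smul, ← sub_eq_add_neg]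

omit [Fintype S] in
/-- **(28), the two printed forms of the current**: `J = D*η⁻²Im ∂U₀ = Im η⁻²D*∂U₀` — for a UNITARY background the
involution commutes with `D^{η*}_{U₀}`, so `B9Eq39Adjoint.J` (= `D^{η*}(η⁻² Im ∂U₀)`) equals `η⁻²·Im(D^{η*}∂U₀)` at every
bond. [cite: Balaban1985Variational, (28) p.282] -/
theorem J_eq_imPart_div (hU : ∀ μ x, (((U μ x)⁻¹ : 𝔸ˣ) : 𝔸) = star (U μ x : 𝔸)) (η : ℝ) (μ : ι) (x : S) :
    B9Eq39Adjoint.J T U η μ x = (((η : ℂ)⁻¹) ^ 2) • imPart (divPη T U η (plaqField T U) μ x) := by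
  have hfield : (fun κ ν y => (((η : ℂ)⁻¹) ^ 2) • imC (plaqU T U κ ν y)) =
      (((η : ℂ)⁻¹) ^ 2) • ((2 * I)⁻¹ • (plaqField T U - star (plaqField T U))) := by
    funext κ ν y
    simp only [Pi.smul_apply, Pi.sub_apply, Pi.star_apply, plaqField,
      imC_eq_imPart (plaqU_unitary T U hU κ ν y), imPart]
  rw [B9Eq39Adjoint.J, hfield, divPη_smul, divPη_smul, divPη_sub, divPη_star T U hU, imPart]

end Lattice

/-! ## §3 (28): the bound `|J| < C₁B₃ε₁(Lʲη)⁻³` from the assumption (14) -/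
section Bound

variable {𝔸 : Type*} [NormedRing 𝔸] [NormedAlgebra ℂ 𝔸] [StarRing 𝔸] [NormedStarGroup 𝔸] [StarModule ℂ 𝔸]
variable {S : Type*} {ι : Type*} [Fintype ι] [LinearOrder ι]
variable (T : ι → Equiv.Perm S) (U : ι → S → 𝔸ˣ)

omit [StarModule ℂ 𝔸] in
/-- `‖Im X‖ ≤ ‖X‖` (`‖X*‖ = ‖X‖`). [cite: Balaban1985Variational, (28) p.282] -/
theorem norm_imPart_le (X : 𝔸) : ‖imPart X‖ ≤ ‖X‖ := by
  unfold imPart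
  rw [norm_smul, norm_inv, norm_mul, Complex.norm_two, Complex.norm_I, mul_one]
  calc 2⁻¹ * ‖X - star X‖ ≤ 2⁻¹ * (‖X‖ + ‖star X‖) :=
        mul_le_mul_of_nonneg_left (norm_sub_le _ _) (by norm_num)
    _ = ‖X‖ := by rw [norm_star]; ring

/-- **(28)** «|J| < C₁B₃ε₁(Lʲη)⁻³ on Ω_j, the bound holds by the assumption (14)»: if at the bond `b` the background
satisfies the (2)-form of (14), `‖(D^{η*}_{U₀}∂U₀)(b)‖ ≤ C₁B₃ε₁·η²·t⁻³` (`t = Lʲη`, `η > 0`), then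
`‖J(b)‖ ≤ C₁B₃ε₁·t⁻³` (unitary `U₀`; `J = η⁻²Im(D*∂U₀)` and `‖Im X‖ ≤ ‖X‖`). [cite: Balaban1985Variational, (28) p.282] -/
theorem ineq28 (hU : ∀ μ x, (((U μ x)⁻¹ : 𝔸ˣ) : 𝔸) = star (U μ x : 𝔸)) {η : ℝ} (hη : 0 < η) {C₁ B₃ ε₁ t : ℝ}
    (μ : ι) (x : S) (h14 : ‖divPη T U η (plaqField T U) μ x‖ ≤ C₁ * B₃ * ε₁ * η ^ 2 * t⁻¹ ^ 3) :
    ‖B9Eq39Adjoint.J T U η μ x‖ ≤ C₁ * B₃ * ε₁ * t⁻¹ ^ 3 := by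
  rw [J_eq_imPart_div T U hU, norm_smul, norm_pow, norm_inv, Complex.norm_real, Real.norm_of_nonneg hη.le]
  calc η⁻¹ ^ 2 * ‖imPart (divPη T U η (plaqField T U) μ x)‖
      ≤ η⁻¹ ^ 2 * (C₁ * B₃ * ε₁ * η ^ 2 * t⁻¹ ^ 3) :=
        mul_le_mul_of_nonneg_left ((norm_imPart_le _).trans h14) (by positivity)
    _ = C₁ * B₃ * ε₁ * t⁻¹ ^ 3 := by field_simp

end Bound

end Literature.MathematicalPhysics.QuantumFieldTheory.Balaban1983to89.B11Eq27Current
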